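import Summits.BirchSwinnertonDyer.Rank1Residual.F1Sign2.LevelZeroSpinLawAtTwo
import HarnessLib

/-!
# DESC-39 kernel — -desc g29's sanity examples (Sketch39, VERBATIM) + REF1-AUDIT §253's probes for `F1Sign2/LevelZeroSpinLawAtTwo.lean` (typer -ty g20)

CONTENT (all PROVED, no `sorry`, no new `def`): -desc's two `example`s (`QuadUnramifiedAt (−3) 2`; `17` a square mod `2^k`, `k ≤ 5`, by `decide`); REF1 §253 probes
(`REF1-data/b253/Probe253.lean` 48d35c4d9829cc5b) named as theorems: P1 `switchedOffAt_of_good` (polarity), P3 `false_of_allOff_of_twoOn` (DESC-39-A and DESC-39-B never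
speak about the same curve), P5 `isAdicSquare_zero` (junk at `D = 0`, harmless under `CubicDatumFor`), P6 `false_of_oneLocalRootC_of_threeLocalRootsC` (exclusive), P7
`oneLocalRootC_of_ramifiedPairC`; P2 (the `n = 0` firing of the `I n` clause) is DROPPED because rider R253a's `0 < n` — applied in the port — removes exactly that firing, and
the typer's `switchedOffAt_of_I_nonsplit_four_dvd` checks the edited clause still yields THM 39.1 (ii)'s multiplicative cell.
BSD is not proved by this; 23715 is not closed by this.
-/

noncomputable section

open scoped Classical

open WeierstrassCurve Literature.NumberTheory.EllipticCurves Literature.NumberTheory.DiophantineGeometry Polynomial IsDedekindDomain NumberField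

namespace Summit.BirchSwinnertonDyer.Rank1Residual.F1Sign2.LevelZeroSpinLaw.Kernel

/-! ### -desc g29 sanity examples (Sketch39, VERBATIM): the vocabulary is inhabited / non-trivial on integers -/

/-- `−3 = 4⁰·(−3)`, `−3 ≡ 1 (mod 4)`: `ℚ₂(√−3)` is the unramified quadratic field. -/
example : QuadUnramifiedAt (-3) 2 := by
  refine ⟨?_, fun _ => ⟨0, -3, by norm_num, by decide⟩⟩
  have : padicValInt 2 (-3) = 0 := by
    rw [padicValInt]; simp
  rw [this]; exact ⟨0, rfl⟩

/-- `17 ≡ 1 (mod 8)` is a 2-adic square: a square root mod `2^k` for every `k` exists — checked here for `k ≤ 5` by `decide` (the `∀ k` statement is Hensel). -/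
example : ∀ k ∈ Finset.range 6, ∃ x : ZMod (2 ^ k), x ^ 2 = (17 : ZMod (2 ^ k)) := by decide

/-! ### REF1-AUDIT §253 probes (`REF1-data/b253/Probe253.lean` 48d35c4d9829cc5b, namespace `REF1_253`; REF1's `example`s named as theorems by the typer, statements and
proofs VERBATIM; P2 — the reading note that the `I n` clause fired at `n = 0` — is DROPPED: rider R253a (`0 < n`) removed exactly that firing; P4 is a remark) -/

/-- REF1 §253 P1 (polarity): a good place is switched off by the first disjunct. -/
theorem switchedOffAt_of_good (W : WeierstrassCurve ℚ) (c : ℤ[X]) (v : HeightOneSpectrum (𝓞 ℚ)) (ℓ : ℕ)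
    (h : W.HasGoodReductionAt v) : SwitchedOffAt W c v ℓ := Or.inl h

/-- REF1 §253 P3 (consistency of DESC-39-A with DESC-39-B): their hypotheses are jointly unsatisfiable (ON := ¬OFF ∧ …). -/
theorem false_of_allOff_of_twoOn (W : WeierstrassCurve ℚ) (c : ℤ[X])
    (hoff : ∀ (v : HeightOneSpectrum (𝓞 ℚ)) (ℓ : ℕ), PlaceOver v ℓ → SwitchedOffAt W c v ℓ)
    (hon : ∃ (v v' : HeightOneSpectrum (𝓞 ℚ)) (ℓ ℓ' : ℕ), v ≠ v' ∧ PlaceOver v ℓ ∧ PlaceOver v' ℓ' ∧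
      SwitchedOnAt W c v ℓ ∧ SwitchedOnAt W c v' ℓ') : False := by
  obtain ⟨v, -, ℓ, -, -, hv, -, hon, -⟩ := hon
  exact hon.1 (hoff v ℓ hv)

/-- REF1 §253 P5 (junk of the carriers at `D = 0`): `IsAdicSquare 0 ℓ` holds (harmless: `disc c ≠ 0` under `CubicDatumFor`). -/
theorem isAdicSquare_zero (ℓ : ℕ) : IsAdicSquare 0 ℓ := fun k => ⟨0, by simp⟩

/-- REF1 §253 P6: `OneLocalRootC` and `ThreeLocalRootsC` are exclusive (so `d_ℓ` is well defined by the carriers). -/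
theorem false_of_oneLocalRootC_of_threeLocalRootsC (c : ℤ[X]) (ℓ : ℕ) (h1 : OneLocalRootC c ℓ) (h3 : ThreeLocalRootsC c ℓ) :
    False := h1.2 h3.2

/-- REF1 §253 P7: a ramified pair excludes three local roots (`RamifiedPairC ⊆ OneLocalRootC`). -/
theorem oneLocalRootC_of_ramifiedPairC (c : ℤ[X]) (ℓ : ℕ) (h : RamifiedPairC c ℓ) : OneLocalRootC c ℓ := h.1

/-- Typer's check of rider R253a (REF1 §253): after the edit the `I n` clause needs `0 < n`, and an `I n` place with `0 < n` that is non-split with `4 ∣ n` is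
still switched off (the multiplicative cell of THM 39.1 (ii), syntactically). -/
theorem switchedOffAt_of_I_nonsplit_four_dvd (W : WeierstrassCurve ℚ) (c : ℤ[X]) (v : HeightOneSpectrum (𝓞 ℚ)) (ℓ n : ℕ)
    (hn : 0 < n) (hk : W.kodairaSymbolAt v = KodairaSymbol.I n) (hns : ¬ W.HasSplitMultiplicativeReductionAt v) (h4 : 4 ∣ n) :
    SwitchedOffAt W c v ℓ :=
  Or.inr (Or.inr (Or.inr (Or.inl ⟨n, hn, hk, Or.inl ⟨hns, h4⟩⟩)))

end Summit.BirchSwinnertonDyer.Rank1Residual.F1Sign2.LevelZeroSpinLaw.Kernel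

end
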